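import Summits.BirchSwinnertonDyer.BirchSwinnertonDyer.Theorems.ClassRecordThreeKolyvaginShaOrderAtPrimeDivisible
import Literature.NumberTheory.EllipticCurves.HeegnerPointsKolyvaginPrimaryPointsProofs
import HarnessLib

/-!
# Kolyvagin's bound on `Ш(E/K)[p^∞]` (order form) AT ONE odd surjective prime `p`, REFINED by global
# divisibility, from Heegner-type points whose derived classes are killed by `p^{M−t}`, Kolyvagin
# reciprocity (pairing form) at `p`, and the Cassels–Tate inputs (cell `bsd-stepL`, seat
# `bsd-stepL-tam3-p1` g9, crux stmt-BirchSwinnertonDyer-19109; sibling of x11b3-p2's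
# `X11b/KolyvaginShaOrderOfPoints`, cell `b2b-bsdres`)

HONEST FRAMING: ONE THEOREM (no definition, no named fact, no `sorry`); CONDITIONAL on every displayed
binder; nothing booked; no mark / label / count / tier moved; BSD is not proved for any curve. This is
x11b3-p2's `KolyvaginOrder.card_sha_primary_le_at_of_pointsM_of_reciprocityFinset_of_localDuality`
VERBATIM with ONE extra clause in the `hpoints` binder — at every level `p^M` and every square-free
Kolyvagin product `m`, the Kolyvagin class of the derived point `P_m` is killed by `p^{M−t}` (i.e. `P_m`
is `p^t`-divisible in `E(K_m)`: McCallum (5)–(6), Cor. 4.5; Jetchev's `m(c) ≥ t`) — and the REFINED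
conclusion `#Ш(E/K)[p^∞] ≤ p^{2(M₀−t)}`, `ord_p #Ш(E/K)[p^∞] + 2t ≤ 2M₀` (whence `t ≤ M₀`) = McCallum's Cor. 5.6
read as the UPPER bound with `m ≥ t` = the kernel shape (at one prime, modulo the displayed inputs) of
the named fact `McCallum1991_padicValNat_card_sha_primary_add_le_of_globalDivisibility` (hMcU of 19109's
`stub_factsAtThree`). Proof = the sibling's: the leaves are assembled from the points by the tree's
`exists_leafA_of_points` recipe (here inlined, the class being `kolyvaginClass … (Pt m)` so that the
divisibility clause passes through), `hdual_of_kolyvaginReciprocityFinset`,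
`hdual₂_of_kolyvaginReciprocityFinset`, then this seat's
`KolyvaginOrder.card_sha_primary_le_at_of_leavesM₂Div_of_localDuality`; `hC` / `hW` DISCHARGED by
`Automorphic.chebotarev_artinRep_holds` / `exists_weilPairing_holds` as in the sibling.

References (locators only): [cite: McCallumLMS1991, §1 Theorem (Kolyvagin), §4 (5)–(6), Cor. 4.5,
Lemma 5.1, §5 Thm. 5.4, Cor. 5.6] [cite: Jetchev2008, p. 812 (1), Cor. 1.5]
[cite: GrossLMS1991, §2 Thm. 2.2 (2), §§3–8, §10] [cite: MilneADT2006, Ch. I §6, Prop. 6.9, Thm. 6.13(a)].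
-/

noncomputable section

open scoped Classical Pointwise

namespace Summit.BirchSwinnertonDyer.Rank1Residual.X11b.KolyvaginOrder
open WeierstrassCurve NumberField IsDedekindDomain Field Function
open Literature.NumberTheory.EllipticCurves Literature.NumberTheory.EllipticCurves.KolyvaginDescent
open Literature.NumberTheory.GaloisRepresentations
open Literature.NumberTheory.GaloisCohomology
open Literature.NumberTheory.GaloisRepresentations.DiscreteGaloisModule (mu MuCarrier)

-- Cup products need `LocallyCompactSpace Γ_K`; as in the tree's Cassels–Tate files.
attribute [local instance] absoluteGaloisGroup_compactSpace

-- `CharZero` of the completions (the Cassels–Tate local terms), as in the tree's files.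
attribute [local instance] charZero_placeCompletion

variable (W : WeierstrassCurve ℚ) {K : Type} [Field K] [NumberField K]

/-- **Kolyvagin's bound on `Ш(E/K)[p^∞]` at one odd prime `p` with `ρ̄_{E,p}` onto, order form,
REFINED by global divisibility, from Heegner-type points (with `p^{M−t}`-killed derived classes) and
Kolyvagin reciprocity (pairing form) at `p` and the Cassels–Tate inputs at level `p^{M₀}`** (McCallum 1991
Cor. 5.6 as the upper bound with `m ≥ t`; Jetchev 2008 (1); module docstring): `Ш(E/K)[p^∞]` finite,
killed by `p^{M₀}`, `#Ш(E/K)[p^∞] ≤ p^{2(M₀−t)}`, `ord_p #Ш(E/K)[p^∞] + 2t ≤ 2M₀`.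
[cite: McCallumLMS1991, §1 Theorem (Kolyvagin), Lemma 5.1, §2 Prop. 2.2, Thm. 5.4, Cor. 5.6]
[cite: Jetchev2008, p. 812 (1) and Cor. 1.5] [cite: GrossLMS1991, §2 Thm. 2.2 (2), §§3–8, §10]
[cite: MilneADT2006, Ch. I §6, Prop. 6.9, Thm. 6.13(a)] -/
theorem card_sha_primary_le_at_of_pointsMDiv_of_reciprocityFinset_of_localDuality [W.IsElliptic]
    (hK : IsImaginaryQuadratic K) {N₀ : ℕ} [NeZero N₀] {P : (W.baseChange K).toAffine.Point}
    (hP : IsHeegnerPoint N₀ W K P) (hnt : ¬ IsOfFinAddOrder P) {p : ℕ} (hp : p.Prime) (hp2 : p ≠ 2)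
    (hρ : W.HasSurjectiveModNGaloisRep p) {M₀ : ℕ} (hM₀ : 1 ≤ M₀) [NeZero (p ^ M₀)]
    {c : K ≃ₐ[ℚ] K} (hc : c ≠ 1) (hcc : c * c = 1)
    {x₀ : (W.baseChange K).toAffine.Point} (hx₀ : p ^ M₀ • x₀ = P)
    (hmax : ∀ Q : (W.baseChange K).toAffine.Point, p ^ (M₀ + 1) • Q ≠ P)
    (t : ℕ)
    (hpoints : ∀ {M : ℕ} (_hM : 1 ≤ M)
      (hdiv : ∀ Q : geomPoints (W.baseChange K), ∃ R, ((p ^ M : ℕ) : ℤ) • R = Q)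
      (c : K ≃ₐ[ℚ] K) (_hc : c ≠ 1),
      ∃ (ε : ℤ) (τ : AlgebraicClosure K ≃+* AlgebraicClosure K) (hτ : IsLiftOfAut c τ)
        (A : ℕ → AddSubgroup (geomPoints (W.baseChange K)))
        (hA : ∀ m, KolyvaginCocycle.IsAdmissible (Field.absoluteGaloisGroup K) (A m)
          ((p ^ M : ℕ) : ℤ))
        (Pt : ℕ → geomPoints (W.baseChange K))
        (hPt : ∀ m, Pt m ∈
          KolyvaginCocycle.invPoints (Field.absoluteGaloisGroup K) (A m) ((p ^ M : ℕ) : ℤ)),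
        (ε = 1 ∨ ε = -1) ∧
        IsOfFinAddOrder (Affine.Point.map (W' := W) (c : K →ₐ[ℚ] K) P - ε • P) ∧
        (∀ m, ∀ a ∈ A m, hτ.pointsMap W a ∈ A m) ∧
        Pt 1 = toGeomPoints (W.baseChange K) P ∧
        (∀ m : ℕ, Squarefree m →
          (∀ q ∈ m.primeFactors, IsKolyvaginPrime N₀ W K p q ∧ FrobEqFrobInfty W K (p ^ M) q) →
          (∃ B ∈ A m, hτ.pointsMap W (Pt m) =
            (ε * (-1) ^ m.primeFactors.card) • Pt m + ((p ^ M : ℕ) : ℤ) • B) ∧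
          (∀ v : HeightOneSpectrum (𝓞 K), (m : 𝓞 K) ∉ v.asIdeal →
            kolyvaginClass (W.baseChange K) _ hdiv (hA m) (Pt m) (hPt m) ∈
              selmerLocalKer (W.baseChange K) (v.adicCompletion K) ((p ^ M : ℕ) : ℤ)) ∧
          (∀ ℓ : ℕ, ℓ.Prime → ℓ ∣ m → ∀ v : HeightOneSpectrum (𝓞 K), (ℓ : 𝓞 K) ∈ v.asIdeal →
            ∀ a : ℕ, (((p : ℤ) ^ a) •
                kolyvaginClass (W.baseChange K) _ hdiv (hA m) (Pt m) (hPt m) ∈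
                selmerLocalKer (W.baseChange K) (v.adicCompletion K) ((p ^ M : ℕ) : ℤ) ↔
              ((p : ℤ) ^ a) • kolyvaginClass (W.baseChange K) _ hdiv (hA (m / ℓ)) (Pt (m / ℓ))
                  (hPt (m / ℓ)) ∈
                (W.baseChange K).torsionLocalKer (v.adicCompletion K) ((p ^ M : ℕ) : ℤ))) ∧
          -- GLOBAL DIVISIBILITY to depth `t`: the class of `P_m` is killed by `p^{M−t}`
          ((p : ℤ) ^ (M - t)) • kolyvaginClass (W.baseChange K) _ hdiv (hA m) (Pt m) (hPt m) = 0))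
    (hRT : ∀ {M : ℕ} (_hM : 1 ≤ M) {ℓ : ℕ} (hℓ : IsKolyvaginPrime N₀ W K p ℓ),
      FrobEqFrobInfty W K (p ^ M) ℓ →
      ∃ (A : Type) (_ : AddCommGroup A)
        (e : geomTorsion (W.baseChange K) ((p ^ M : ℕ) : ℤ) →+
          geomTorsion (W.baseChange K) ((p ^ M : ℕ) : ℤ) →+ A),
        (∀ x, e x x = 0) ∧ (∀ x, (∀ y, e x y = 0) → x = 0) ∧
        ∀ (T : Finset (HeightOneSpectrum (𝓞 K))),
        ∀ s ∈ selmerGroup (W.baseChange K) ((p ^ M : ℕ) : ℤ),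
          (∀ v ∈ T, s ∈ (W.baseChange K).torsionLocalKer (v.adicCompletion K) ((p ^ M : ℕ) : ℤ)) →
          ∀ c' : galH1Torsion (W.baseChange K) ((p ^ M : ℕ) : ℤ),
          (∀ v : HeightOneSpectrum (𝓞 K), v ∉ T → (ℓ : 𝓞 K) ∉ v.asIdeal →
            c' ∈ selmerLocalKer (W.baseChange K) (v.adicCompletion K) ((p ^ M : ℕ) : ℤ)) →
          (∀ w : InfinitePlace K,
            c' ∈ selmerLocalKer (W.baseChange K) w.Completion ((p ^ M : ℕ) : ℤ)) →
          ∀ 𝔔 ∈ hℓ.place.primesAbove, ∀ F : Field.absoluteGaloisGroup K,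
            IsArithFrobAt (𝓞 K) F 𝔔 →
            F ∈ torsionFixing (W.baseChange K) ((p ^ M : ℕ) : ℤ) →
            ∀ σ ∈ 𝔔.inertia (Field.absoluteGaloisGroup K),
            e (h1Eval (W.baseChange K) ((p ^ M : ℕ) : ℤ) s F)
              (h1Eval (W.baseChange K) ((p ^ M : ℕ) : ℤ) c' σ) = 0)
    (e : geomTorsion (W.baseChange K) ((p ^ M₀ * p ^ M₀ : ℕ) : ℤ) →
      geomTorsion (W.baseChange K) ((p ^ M₀ * p ^ M₀ : ℕ) : ℤ) → AlgebraicClosure K)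
    (hμ : ∀ S T, e S T ^ (p ^ M₀ * p ^ M₀) = 1)
    (hadd₁ : ∀ S₁ S₂ T, e (S₁ + S₂) T = e S₁ T * e S₂ T)
    (hadd₂ : ∀ S T₁ T₂, e S (T₁ + T₂) = e S T₁ * e S T₂)
    (hgal : ∀ (σ : absoluteGaloisGroup K) (S T : geomTorsion (W.baseChange K) ((p ^ M₀ * p ^ M₀ : ℕ) : ℤ)),
      σ • e S T = e (σ • S) (σ • T))
    (halt : ∀ T, e T T = 1) (hnondeg : ∀ T, (∀ S, e S T = 1) → T = 0)
    (inv : LocalInvariants K (p ^ M₀ * p ^ M₀)) (hPT' : inv.SumInvLocalizationEqZero)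
    (hinv : ∀ v : HeightOneSpectrum (𝓞 K), Injective (inv (Sum.inr v)))
    (hH3 : ∀ x : galoisCohomology (mu K (p ^ M₀ * p ^ M₀)) 3,
      (∀ v : Place K, galoisCohomology.localization (mu K (p ^ M₀ * p ^ M₀)) v 3 x = 0) → x = 0)
    (hB : Literature.GroupTheory.FiniteAbelian.IsLevelPairing (p ^ M₀)
      (ctLevelPairing (W.baseChange K) (p ^ M₀) e hμ hadd₁ hadd₂ hgal inv halt hPT' hH3
        (localTerm_finite_support (W := W.baseChange K) (m := p ^ M₀) (e := e) (hμ := hμ)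
          (hadd₁ := hadd₁) (hadd₂ := hadd₂) (hgal := hgal) halt inv)))
    (hPτ : ∀ z ∈ selmerGroup (W.baseChange K) ((p ^ M₀ * p ^ M₀ : ℕ) : ℤ),
      ∀ t ∈ selmerGroup (W.baseChange K) ((p ^ M₀ * p ^ M₀ : ℕ) : ℤ),
      ctGeneralFun (W.baseChange K) (p ^ M₀) e hμ hadd₁ hadd₂ hgal inv
          (torsionH1ToH1 (W.baseChange K) _ (conjAct W c _ z))
          (torsionH1ToH1 (W.baseChange K) _ (conjAct W c _ t)) =
        ctGeneralFun (W.baseChange K) (p ^ M₀) e hμ hadd₁ hadd₂ hgal inv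
          (torsionH1ToH1 (W.baseChange K) _ z) (torsionH1ToH1 (W.baseChange K) _ t)) :
    Finite (AddCommGroup.primaryComponent (W.baseChange K).sha p) ∧
    (∀ c ∈ AddCommGroup.primaryComponent (W.baseChange K).sha p, p ^ M₀ • c = 0) ∧
    Nat.card (AddCommGroup.primaryComponent (W.baseChange K).sha p) ≤ p ^ (2 * (M₀ - t)) ∧
    padicValNat p (Nat.card (AddCommGroup.primaryComponent (W.baseChange K).sha p)) + 2 * t ≤
      2 * M₀ := by
  refine card_sha_primary_le_at_of_leavesM₂Div_of_localDuality W hK hP hnt hp hp2 hρ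
    Literature.NumberTheory.Automorphic.chebotarev_artinRep_holds (W.exists_weilPairing_holds p) hM₀
    hc hcc hx₀ hmax t ?_ e hμ hadd₁ hadd₂ hgal halt hnondeg inv hPT' hinv hH3 hB hPτ
  intro M hM hdiv c₁ hc₁
  obtain ⟨ε, τ, hτ, A, hA, Pt, hPt, hε, h53, hAτ, hPt1, hm'⟩ := hpoints hM hdiv c₁ hc₁
  -- leaf (A) from the points, the class being `kolyvaginClass … (Pt m)` (the tree's
  -- `exists_leafA_of_points` recipe, inlined so that the divisibility clause passes through)
  have h1 : toGeomPoints (W.baseChange K) P ∈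
      KolyvaginCocycle.invPoints (Field.absoluteGaloisGroup K) (A 1) ((p ^ M : ℕ) : ℤ) := by
    rw [← hPt1]; exact hPt 1
  have hc1 : kolyvaginClass (W.baseChange K) _ hdiv (hA 1) (Pt 1) (hPt 1) =
      kummerMapTorsion (W.baseChange K) _ hdiv P := by
    rw [kolyvaginClass_congr_point (hA 1) (hP' := h1) hPt1]
    exact kolyvaginClass_toGeomPoints (hA 1) P h1
  refine ⟨ε, fun m ↦ kolyvaginClass (W.baseChange K) _ hdiv (hA m) (Pt m) (hPt m), hε, h53, hc1,
    fun m hm hkol ↦ ⟨conjAct_kolyvaginClass_eq_smul W hτ (hA m) (hAτ m) (hPt m) _ (hm' m hm hkol).1,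
      (hm' m hm hkol).2.1, (hm' m hm hkol).2.2.1⟩,
    hdual_of_kolyvaginReciprocityFinset W hK hP hp hp2 hM hc₁ (fun hℓ hℓM ↦ hRT hM hℓ hℓM),
    hdual₂_of_kolyvaginReciprocityFinset W hK hP hp hp2 hM hc₁ (fun hℓ hℓM ↦ hRT hM hℓ hℓM),
    fun m hm hkol ↦ (hm' m hm hkol).2.2.2⟩

end Summit.BirchSwinnertonDyer.Rank1Residual.X11b.KolyvaginOrder

end
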